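import Summits.Ventures.DiscreteObjects.UnitDistance.DistanceTwoForcing
import HarnessLib

/-!
# Forcing chains: bootstrapped forced pairs at several distances, and the distance-two conclusion
(cell `pub-namedobj`, target (U), seat udg g29)

Framing (verbatim for the cell): lottery ticket; floor = certified bounds/negative ranges.

THEORY-U28 §5 ('bootstrapping') asked for the transport lemma for colourings that respect a finite SET of already-forced distances.
This file proves it, for any colour type `γ` and any subfield `K ⊆ ℝ`:

* `pairs_ne_of_forcing_chain` — let `S₀, …, S_{n−1} ⊆ K²` be configurations with distinguished pairs `P i ≠ Q i` in `S i`.  Suppose stage `i`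
  is CONDITIONALLY forcing: every proper `γ`-colouring of the unit-distance graph on `S i` in which all pairs of `S i` at the earlier
  distances `dist (P j) (Q j)`, `j < i`, are bichromatic gives `P i` and `Q i` different colours.  Then in every proper `γ`-colouring of
  `K²` ALL pairs at ALL the distances `dist (P i) (Q i)` are bichromatic (strong induction on `i`; the step is udg g22/g27's `K`-rational
  rotation `rotMove`, which is an isometry of `K²`, so the pulled-back colouring of `S i` inherits the earlier bichromatic distances).
* `not_colorable_three_of_forcing_chain` — if moreover `K ∋ r` with `r² = 12k − 1`, `k ≥ 1` (e.g. `K = ℚ(√d)`, `d ≡ 11 (mod 12)`) and some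
  stage has `dist (P i) (Q i) = 2`, then `K²` is not `3`-colourable (udg g27's `not_colorable_three_of_dist_two_bichromatic`).
* `not_colorable_three_of_two_stage_forcing` — the two-stage special case spelled out (one auxiliary distance `δ`, then distance `2`).

With `n = 1` this is exactly `DistanceTwoForcing.not_colorable_three_of_dist_two_forced`; the point of the chain is that a stage may be
3-colourable with its pair NOT forced outright, as long as it is forced given the virtual edges supplied by the earlier stages — each stage
is then a separate, smaller finite certificate.  Elementary; ours; nothing here is literature.
-/

noncomputable section

namespace Summit.Ventures.DiscreteObjects.UnitDistance

open SimpleGraph ForcedPair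

/-- FORCING CHAIN TRANSPORT (any colour type).  Stages `S i ⊆ K²` with pairs `P i ≠ Q i`; if every stage is forcing CONDITIONALLY on
the bichromaticity of all pairs at the earlier stages' distances, then every proper `γ`-colouring of `K²` makes every pair at every
stage distance bichromatic. -/
theorem pairs_ne_of_forcing_chain {γ : Type*} (K : IntermediateField ℚ ℝ) {n : ℕ} (S : Fin n → Set Pt)
    (hS : ∀ i, S i ⊆ fieldPoints K) (P Q : Fin n → Pt) (hP : ∀ i, P i ∈ S i) (hQ : ∀ i, Q i ∈ S i) (hPQ : ∀ i, P i ≠ Q i)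
    (hforced : ∀ i, ∀ C' : (planeUnitDistanceGraph.induce (S i)).Coloring γ,
      (∀ j, j < i → ∀ p q : S i, dist (p : Pt) q = dist (P j) (Q j) → C' p ≠ C' q) →
      C' ⟨P i, hP i⟩ ≠ C' ⟨Q i, hQ i⟩)
    (C : (planeUnitDistanceGraph.induce (fieldPoints K)).Coloring γ) :
    ∀ i : Fin n, ∀ p q : fieldPoints K, dist (p : Pt) q = dist (P i) (Q i) → C p ≠ C q := by
  suffices h : ∀ m : ℕ, ∀ i : Fin n, (i : ℕ) = m → ∀ p q : fieldPoints K, dist (p : Pt) q = dist (P i) (Q i) → C p ≠ C q from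
    fun i => h i i rfl
  intro m
  induction m using Nat.strong_induction_on with
  | _ m ih =>
    intro i hi p q hd
    obtain ⟨hα, hβ⟩ := alphaOf_mem ((hS i) (hP i)) ((hS i) (hQ i)) p.2 q.2
    have hαβ := alpha_sq_add_beta_sq (hPQ i) hd
    -- the pulled-back colouring of stage `i`
    let C' := pullbackGen C (S i) (hS i) hα hβ hαβ ((hS i) (hP i)) p.2
    have hyp : ∀ j, j < i → ∀ p' q' : S i, dist (p' : Pt) q' = dist (P j) (Q j) → C' p' ≠ C' q' := by
      intro j hj p' q' hd'
      show pullbackGen C (S i) (hS i) hα hβ hαβ ((hS i) (hP i)) p.2 p' ≠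
        pullbackGen C (S i) (hS i) hα hβ hαβ ((hS i) (hP i)) p.2 q'
      rw [pullbackGen_apply, pullbackGen_apply]
      refine ih j (by omega) j rfl _ _ ?_
      show dist (rotMove (P i) p (alphaOf (P i) (Q i) p q) (betaOf (P i) (Q i) p q) p')
          (rotMove (P i) p (alphaOf (P i) (Q i) p q) (betaOf (P i) (Q i) p q) q') = dist (P j) (Q j)
      rw [dist_rotMove (P i) p hαβ, hd']
    have h := hforced i C' hyp
    have e1 : (⟨rotMove (P i) p (alphaOf (P i) (Q i) p q) (betaOf (P i) (Q i) p q) (P i),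
        rotMove_mem hα hβ ((hS i) (hP i)) p.2 ((hS i) (hP i))⟩ : fieldPoints K) = p :=
      Subtype.ext (rotMove_base (P i) p _ _)
    have e2 : (⟨rotMove (P i) p (alphaOf (P i) (Q i) p q) (betaOf (P i) (Q i) p q) (Q i),
        rotMove_mem hα hβ ((hS i) (hP i)) p.2 ((hS i) (hQ i))⟩ : fieldPoints K) = q :=
      Subtype.ext (rotMove_apply_Q (hPQ i))
    have h' : pullbackGen C (S i) (hS i) hα hβ hαβ ((hS i) (hP i)) p.2 ⟨P i, hP i⟩ ≠
        pullbackGen C (S i) (hS i) hα hβ hαβ ((hS i) (hP i)) p.2 ⟨Q i, hQ i⟩ := h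
    rw [pullbackGen_apply, pullbackGen_apply, e1, e2] at h'
    exact h'

/-- FORCING CHAIN ⇒ NOT 3-COLOURABLE.  `K ∋ r`, `r² = 12k − 1`, `k ≥ 1`; stages as in `pairs_ne_of_forcing_chain` for `γ = Fin 3`; if some
stage's pair is at distance `2`, then `K²` has no proper `3`-colouring. -/
theorem not_colorable_three_of_forcing_chain (K : IntermediateField ℚ ℝ) {r : ℝ} (hr : r ∈ K) (k : ℕ) (hk : 1 ≤ k)
    (hrk : r ^ 2 = 12 * k - 1) {n : ℕ} (S : Fin n → Set Pt) (hS : ∀ i, S i ⊆ fieldPoints K) (P Q : Fin n → Pt)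
    (hP : ∀ i, P i ∈ S i) (hQ : ∀ i, Q i ∈ S i) (hPQ : ∀ i, P i ≠ Q i)
    (hforced : ∀ i, ∀ C' : (planeUnitDistanceGraph.induce (S i)).Coloring (Fin 3),
      (∀ j, j < i → ∀ p q : S i, dist (p : Pt) q = dist (P j) (Q j) → C' p ≠ C' q) →
      C' ⟨P i, hP i⟩ ≠ C' ⟨Q i, hQ i⟩)
    (i₀ : Fin n) (h2 : dist (P i₀) (Q i₀) = 2) :
    ¬ (planeUnitDistanceGraph.induce (fieldPoints K)).Colorable 3 := by
  rintro ⟨C⟩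
  refine not_colorable_three_of_dist_two_bichromatic K hr k hk hrk C ?_
  intro p q hpq
  exact pairs_ne_of_forcing_chain K S hS P Q hP hQ hPQ hforced C i₀ p q (hpq.trans h2.symm)

/-- TWO-STAGE FORCING, spelled out.  Stage one: a configuration `S₁ ⊆ K²` with a pair `P₁ ≠ Q₁` forced different in every proper
`3`-colouring of `S₁` (so all pairs of `K²` at distance `δ = dist P₁ Q₁` are bichromatic — 'virtual edges').  Stage two: a configuration
`S₂ ⊆ K²` with `dist P₂ Q₂ = 2` such that every proper `3`-colouring of `S₂` whose pairs at distance `δ` are all bichromatic gives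
`P₂, Q₂` different colours.  Then, for `K ∋ r` with `r² = 12k − 1`, `K²` is not `3`-colourable. -/
theorem not_colorable_three_of_two_stage_forcing (K : IntermediateField ℚ ℝ) {r : ℝ} (hr : r ∈ K) (k : ℕ) (hk : 1 ≤ k)
    (hrk : r ^ 2 = 12 * k - 1)
    (S₁ : Set Pt) (hS₁ : S₁ ⊆ fieldPoints K) {P₁ Q₁ : Pt} (hP₁ : P₁ ∈ S₁) (hQ₁ : Q₁ ∈ S₁) (hPQ₁ : P₁ ≠ Q₁)
    (hforced₁ : ∀ C' : (planeUnitDistanceGraph.induce S₁).Coloring (Fin 3), C' ⟨P₁, hP₁⟩ ≠ C' ⟨Q₁, hQ₁⟩)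
    (S₂ : Set Pt) (hS₂ : S₂ ⊆ fieldPoints K) {P₂ Q₂ : Pt} (hP₂ : P₂ ∈ S₂) (hQ₂ : Q₂ ∈ S₂) (h2 : dist P₂ Q₂ = 2)
    (hforced₂ : ∀ C' : (planeUnitDistanceGraph.induce S₂).Coloring (Fin 3),
      (∀ p q : S₂, dist (p : Pt) q = dist P₁ Q₁ → C' p ≠ C' q) → C' ⟨P₂, hP₂⟩ ≠ C' ⟨Q₂, hQ₂⟩) :
    ¬ (planeUnitDistanceGraph.induce (fieldPoints K)).Colorable 3 := by
  have hPQ₂ : P₂ ≠ Q₂ := by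
    intro h; rw [h, dist_self] at h2; norm_num at h2
  -- package the two stages as a chain indexed by `Fin 2`
  let S : Fin 2 → Set Pt := fun i => if i = 0 then S₁ else S₂
  let P : Fin 2 → Pt := fun i => if i = 0 then P₁ else P₂
  let Q : Fin 2 → Pt := fun i => if i = 0 then Q₁ else Q₂
  have hS : ∀ i, S i ⊆ fieldPoints K := by
    intro i; fin_cases i
    · exact hS₁
    · exact hS₂
  have hP : ∀ i, P i ∈ S i := by
    intro i; fin_cases i
    · exact hP₁
    · exact hP₂
  have hQ : ∀ i, Q i ∈ S i := by
    intro i; fin_cases i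
    · exact hQ₁
    · exact hQ₂
  have hPQ : ∀ i, P i ≠ Q i := by
    intro i; fin_cases i
    · exact hPQ₁
    · exact hPQ₂
  refine not_colorable_three_of_forcing_chain K hr k hk hrk S hS P Q hP hQ hPQ ?_ 1 (by simpa [P, Q] using h2)
  intro i C' hyp
  fin_cases i
  · exact hforced₁ C'
  · refine hforced₂ C' ?_
    intro p q hpq
    exact hyp 0 (by decide) p q (by simpa [P, Q] using hpq)

end Summit.Ventures.DiscreteObjects.UnitDistance
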